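import Literature.IUT.LogThetaLattice.PacketLogVolumeBridge
import Literature.IUT.LogVolume.HaarTransport
import HarnessLib

/-!
# [IUTchIII] Proposition 3.9 (i), (ii) — residual clauses DISCHARGED at the Haar-measure models:
# mono-analytic compatibility of (packet-, procession-normalised) log-volumes (abc-iut cell, layer L6;
# proof-only companion of `PacketLogVolumes.lean`, board row F4 of `plan/L6/DISCHARGE-L6.md` v1.5)

S. Mochizuki, *Inter-universal Teichmüller theory III*, kurims manuscript (May 2020), Proposition 3.9 (ii)
"(Mono-analytic Compatibility)", p. 116 [claim: Mochizuki2012, status: disputed]: "… by applying the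
`p_{v_ℚ}`-adic log-volume, where `p_{v_ℚ} = p_v`, on the mono-analytic log-shells '`𝓘_{†𝒟^⊢_v}`' of
Proposition 1.2, (vi), (vii), (viii), and adjusting appropriately to account for the discrepancy between
the 'local holomorphic' integral structures of Proposition 3.1, (ii), and the 'mono-analytic' integral
structures of Proposition 3.2, (ii), one obtains [by a functorial algorithm] log-volumes
`μ^log_{α,v_ℚ} : 𝕄(𝓘^ℚ(^α𝒟^⊢_{v_ℚ})) → ℝ`; `μ^log_{A,v_ℚ} : 𝕄(𝓘^ℚ(^A𝒟^⊢_{v_ℚ})) → ℝ` … which are compatible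
with the log-volumes obtained in (i), relative to the natural poly-isomorphisms of Proposition 3.2, (i).
… the same holds for the procession-normalized versions … Finally … '`𝓕^{⊢×μ}`' in place of '`𝒟^⊢`'".

abc-iut-L6-t4's `Prop39ii_monoAnalyticCompat poly μD μF : Prop := ∀ e ∈ poly, ∀ S, μD S = μF (e '' S)`
(`PacketLogVolumes.lean`, p404053) types this sentence over abstract data. THIS FILE concludes it BY NAME at
the models the cell works with, from campaign-S's Haar-transport engine (`Literature.IUT.LogVolume.
HaarTransport`, `IntegralStructure.logVolume_image_equiv` / `…_image_of_preserves` / `logVolume_neg`,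
`localLogVolume_image_equiv_of_norm_map_eq`):

* `prop39ii_monoAnalyticCompat_of_image_eq` — the schema: any family of maps under which `μF(e(S)) = μD(S)`;
* **`prop39ii_monoAnalyticCompat_integralStructure`** — TWO containers `XD` (mono-analytic side) and `XF`
  (holomorphic side), each a locally compact abelian group with an integral structure, and a
  poly-isomorphism consisting of bicontinuous additive isomorphisms carrying the integral structure of
  `XD` ONTO that of `XF` ("adjusting … for the discrepancy between the … integral structures"): the
  normalised log-volumes are compatible; `…_normalized` = the weighted form (`μ^log/d`);
* **`prop39ii_monoAnalyticCompat_of_preserves`** — one container, poly-isomorphism of automorphisms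
  preserving SOME integral structure (the (Ind2)-type automorphisms `{±1}`, units, lattice isomorphisms);
  **`prop39ii_monoAnalyticCompat_pmOne`** — the literal `{id, −1}`;
* **`prop39ii_monoAnalyticCompat_localField`** — the `p_{v_ℚ}`-adic model: two nonarchimedean local fields
  (e.g. `𝓘^ℚ(^α𝒟^⊢_{v_ℚ}) ≅ K_v ≅ 𝓘^ℚ(^α𝓕_{v_ℚ})`) and a poly-isomorphism of ISOMETRIC bicontinuous additive
  isomorphisms (e.g. isomorphisms of topological fields): campaign-S's `localLogVolume` is compatible;
* `packetLogVolume_image_of_preserves` — abc-iut-L6-t4's weighted PACKET log-volume of (i) on direct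
  product regions is unchanged by factorwise lattice automorphisms (through
  `packetLogVolume_eq_weightedLogVolume`, p405109); `processionNormalized_congr_of_compat` — "the same holds
  for the procession-normalized versions" (averages of compatible volumes are compatible).

Honest framing: these are THEOREMS of Haar measure (uniqueness, campaign S) instantiated in the typer's
vocabulary; what is typed as the poly-isomorphism of Prop. 3.2 (i) on actual `𝒟^⊢`-prime-strips is owned
by abc-iut-L6-t3/L5 (StripFrame) — here the poly-isomorphism is any family of lattice-respecting
bicontinuous additive isomorphisms, which is what the printed "natural poly-isomorphisms" induce on
log-shells ([IUTchIII] Prop. 1.2 (vi)–(viii): isomorphisms of topological modules). Nothing here asserts a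
disputed claim or takes a side on [IUTchIII] Cor. 3.12; typed ≠ endorsed.
-/

noncomputable section

namespace Literature.IUT.LogThetaLattice

open Literature.IUT.LogVolume Literature.IUT.LogVolume.IntegralStructure MeasureTheory Set

universe u v

/-! ### The schema -/

/-- SCHEMA: if every member `e` of the poly-isomorphism transports `μD` to `μF` (`μF(e(S)) = μD(S)` for all
`S`), then abc-iut-L6-t4's `Prop39ii_monoAnalyticCompat poly μD μF` holds.
[claim: Mochizuki2012, status: disputed] -/
theorem prop39ii_monoAnalyticCompat_of_image_eq {XD XF : Type u} (poly : Set (XD ≃ XF))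
    (μD : Set XD → ℝ) (μF : Set XF → ℝ) (h : ∀ e ∈ poly, ∀ S : Set XD, μF (e '' S) = μD S) :
    Prop39ii_monoAnalyticCompat poly μD μF :=
  fun e he S => (h e he S).symm

/-! ### Two containers with integral structures: transport along lattice-respecting isomorphisms -/

section TwoContainers

variable {XD : Type u} [AddCommGroup XD] [TopologicalSpace XD] [IsTopologicalAddGroup XD]
  [MeasurableSpace XD] [BorelSpace XD]
variable {XF : Type u} [AddCommGroup XF] [TopologicalSpace XF] [IsTopologicalAddGroup XF]
  [MeasurableSpace XF] [BorelSpace XF]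

/-- **IUTchIII:Prop3.9(ii) at the Haar model, two containers**: `XD` (the mono-analytic log-shell packet
with its integral structure `ΛD`) and `XF` (the holomorphic one, `ΛF`); if every member of the
poly-isomorphism is (the underlying bijection of) a bicontinuous additive isomorphism carrying `ΛD` onto
`ΛF`, then the `ΛD`- and `ΛF`-normalised log-volumes are compatible: `μ^log_D(S) = μ^log_F(e(S))` for all
`e`, `S` (campaign-S `IntegralStructure.logVolume_image_equiv`, Haar uniqueness).
[claim: Mochizuki2012, status: disputed] -/
theorem prop39ii_monoAnalyticCompat_integralStructure (ΛD : IntegralStructure XD)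
    (ΛF : IntegralStructure XF) (poly : Set (XD ≃ XF))
    (hpoly : ∀ e ∈ poly, ∃ φ : XD ≃ₜ+ XF, (⇑φ : XD → XF) = e ∧ φ '' (ΛD : Set XD) = (ΛF : Set XF)) :
    Prop39ii_monoAnalyticCompat poly ΛD.logVolume ΛF.logVolume := by
  refine prop39ii_monoAnalyticCompat_of_image_eq poly _ _ fun e he S => ?_
  obtain ⟨φ, hφe, hφ⟩ := hpoly e he
  rw [← hφe]
  exact ΛD.logVolume_image_equiv ΛF φ hφ S

/-- The same for the WEIGHTED (normalised) log-volumes `μ^log/d` (equal weight `d` on both sides, e.g. the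
common `ℚ_{p_{v_ℚ}}`-dimension of the isomorphic containers; Rmk. 3.1.1 (ii)).
[claim: Mochizuki2012, status: disputed] -/
theorem prop39ii_monoAnalyticCompat_integralStructure_normalized (d : ℕ) (ΛD : IntegralStructure XD)
    (ΛF : IntegralStructure XF) (poly : Set (XD ≃ XF))
    (hpoly : ∀ e ∈ poly, ∃ φ : XD ≃ₜ+ XF, (⇑φ : XD → XF) = e ∧ φ '' (ΛD : Set XD) = (ΛF : Set XF)) :
    Prop39ii_monoAnalyticCompat poly (ΛD.normalizedLogVolume d) (ΛF.normalizedLogVolume d) := by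
  refine prop39ii_monoAnalyticCompat_of_image_eq poly _ _ fun e he S => ?_
  obtain ⟨φ, hφe, hφ⟩ := hpoly e he
  rw [← hφe]
  exact ΛD.normalizedLogVolume_image_equiv ΛF d φ hφ S

end TwoContainers

/-! ### One container: automorphisms preserving some integral structure ((Ind2)-type) -/

section OneContainer

variable {X : Type u} [AddCommGroup X] [TopologicalSpace X] [IsTopologicalAddGroup X]
  [MeasurableSpace X] [BorelSpace X]

/-- **IUTchIII:Prop3.9(ii) at the Haar model, one container**: if every member of the poly-isomorphism is a
bicontinuous additive AUTOMORPHISM mapping SOME integral structure `Λ₀` onto itself (units `𝒪^×`, `±1`,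
`ℤ_p`-lattice isomorphisms of a log-shell), then EVERY normalised log-volume `μ^log_Λ` is compatible with
itself across the poly-isomorphism (campaign-S `logVolume_image_of_preserves`: the modulus of such an
automorphism is `1`). [claim: Mochizuki2012, status: disputed] -/
theorem prop39ii_monoAnalyticCompat_of_preserves (Λ Λ₀ : IntegralStructure X) (poly : Set (X ≃ X))
    (hpoly : ∀ e ∈ poly, ∃ φ : X ≃ₜ+ X, (⇑φ : X → X) = e ∧ φ '' (Λ₀ : Set X) = (Λ₀ : Set X)) :
    Prop39ii_monoAnalyticCompat poly Λ.logVolume Λ.logVolume := by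
  refine prop39ii_monoAnalyticCompat_of_image_eq poly _ _ fun e he S => ?_
  obtain ⟨φ, hφe, hφ⟩ := hpoly e he
  rw [← hφe]
  exact Λ.logVolume_image_of_preserves φ Λ₀ hφ S

/-- The `{±1}` poly-isomorphism ((Ind2) "`{±1}`", [IUTchIII] Prop. 1.2 (vi)/(viii); Rmk. 1.2.3): the identity
and negation of a container are compatible with every normalised log-volume (`logVolume_neg`).
[claim: Mochizuki2012, status: disputed] -/
theorem prop39ii_monoAnalyticCompat_pmOne (Λ : IntegralStructure X) :
    Prop39ii_monoAnalyticCompat ({Equiv.refl X, Equiv.neg X} : Set (X ≃ X)) Λ.logVolume Λ.logVolume := by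
  intro e he S
  rcases he with rfl | he
  · simp
  · rw [Set.mem_singleton_iff] at he
    subst he
    change Λ.logVolume S = Λ.logVolume ((fun x => -x) '' S)
    rw [Set.image_neg_eq_neg, Λ.logVolume_neg]

end OneContainer

/-! ### The `p_{v_ℚ}`-adic model: two local fields and isometric isomorphisms -/

section LocalField

variable (K : Type u) [NontriviallyNormedField K] [IsUltrametricDist K] [ProperSpace K]
  [MeasurableSpace K] [BorelSpace K]
variable (K' : Type u) [NontriviallyNormedField K'] [IsUltrametricDist K'] [ProperSpace K']
  [MeasurableSpace K'] [BorelSpace K']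

/-- **IUTchIII:Prop3.9(ii) at the `p_{v_ℚ}`-adic model**: for two nonarchimedean local fields `K` (carrying
`𝓘^ℚ(^α𝒟^⊢_{v_ℚ})`, with campaign-S's `p`-adic log-volume `localLogVolume K`, `μ(𝒪_K) = 1`) and `K'` (carrying
`𝓘^ℚ(^α𝓕_{v_ℚ})`), and a poly-isomorphism whose members are ISOMETRIC bicontinuous additive isomorphisms
(e.g. isomorphisms of topological fields `K ⥲ K'`, which is what the poly-isomorphisms of
`𝒟^⊢`- or `𝓕^{⊢×μ}`-prime-strips induce), the log-volumes are compatible: `μ^log_K(S) = μ^log_{K'}(e(S))`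
(campaign-S `localLogVolume_image_equiv_of_norm_map_eq`). [claim: Mochizuki2012, status: disputed] -/
theorem prop39ii_monoAnalyticCompat_localField (poly : Set (K ≃ K'))
    (hpoly : ∀ e ∈ poly, ∃ φ : K ≃ₜ+ K', (⇑φ : K → K') = e ∧ ∀ x, ‖φ x‖ = ‖x‖) :
    Prop39ii_monoAnalyticCompat poly (localLogVolume K) (localLogVolume K') := by
  refine prop39ii_monoAnalyticCompat_of_image_eq poly _ _ fun e he S => ?_
  obtain ⟨φ, hφe, hφ⟩ := hpoly e he
  rw [← hφe]
  exact localLogVolume_image_equiv_of_norm_map_eq K K' φ hφ S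

/-- One local field, automorphisms preserving some integral structure (`𝒪_K^×`-multiplications, `±1`,
lattice isomorphisms of the log-shell `𝓘_K`): `μ^log_K` is compatible with itself
(campaign-S `localLogVolume_image_of_preserves`). [claim: Mochizuki2012, status: disputed] -/
theorem prop39ii_monoAnalyticCompat_localField_of_preserves (Λ₀ : IntegralStructure K) (poly : Set (K ≃ K))
    (hpoly : ∀ e ∈ poly, ∃ φ : K ≃ₜ+ K, (⇑φ : K → K) = e ∧ φ '' (Λ₀ : Set K) = (Λ₀ : Set K)) :
    Prop39ii_monoAnalyticCompat poly (localLogVolume K) (localLogVolume K) := by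
  refine prop39ii_monoAnalyticCompat_of_image_eq poly _ _ fun e he S => ?_
  obtain ⟨φ, hφe, hφ⟩ := hpoly e he
  rw [← hφe]
  exact localLogVolume_image_of_preserves K φ Λ₀ hφ S

end LocalField

/-! ### Packets (Prop. 3.9 (i) direct product regions) and processions -/

section Packets

variable {J : Type u} [Fintype J] {U : J → Type v} [∀ j, AddCommGroup (U j)]
  [∀ j, TopologicalSpace (U j)] [∀ j, IsTopologicalAddGroup (U j)] [∀ j, MeasurableSpace (U j)]
  [∀ j, BorelSpace (U j)]

/-- **IUTchIII:Prop3.9(i)/(ii), packets**: abc-iut-L6-t4's weighted packet log-volume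
`packetLogVolume w (Λ_j.haar) T = Σ_j w_j·log μ_j(T_j)` of a direct product region (the `μ^log_{α,v_ℚ}` of (i),
`= IntegralStructure.weightedLogVolume` by `packetLogVolume_eq_weightedLogVolume`, p405109) is UNCHANGED
when every factor is moved by a lattice automorphism of that factor — the factorwise form of the
mono-analytic compatibility / (Ind2)-invariance (campaign-S `weightedLogVolume_image_of_preserves`).
[claim: Mochizuki2012, status: disputed] -/
theorem packetLogVolume_image_of_preserves (Λs : ∀ j, IntegralStructure (U j)) (w : J → ℝ)
    (φ : ∀ j, U j ≃ₜ+ U j) (Λ₀ : ∀ j, IntegralStructure (U j))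
    (hφ : ∀ j, φ j '' (Λ₀ j : Set (U j)) = (Λ₀ j : Set (U j))) (T : ∀ j, Set (U j)) :
    packetLogVolume w (fun j => (Λs j).haar) (fun j => φ j '' T j) =
      packetLogVolume w (fun j => (Λs j).haar) T := by
  rw [packetLogVolume_eq_weightedLogVolume, packetLogVolume_eq_weightedLogVolume]
  exact weightedLogVolume_image_of_preserves Λs w φ Λ₀ hφ T

/-- Factorwise negation leaves the weighted packet log-volume unchanged. [claim: Mochizuki2012, status: disputed] -/
theorem packetLogVolume_neg (Λs : ∀ j, IntegralStructure (U j)) (w : J → ℝ) (T : ∀ j, Set (U j)) :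
    packetLogVolume w (fun j => (Λs j).haar) (fun j => -T j) =
      packetLogVolume w (fun j => (Λs j).haar) T := by
  rw [packetLogVolume_eq_weightedLogVolume, packetLogVolume_eq_weightedLogVolume]
  exact weightedLogVolume_neg Λs w T

end Packets

section Procession

/-- **"the same holds for the procession-normalized versions"** (p. 116): if for each capsule index `j`
the log-volumes `μD_j`, `μF_j` are compatible across the poly-isomorphism `poly_j`, then so are their
procession-normalisations (averages over `j`, abc-iut-L6-t4's `processionNormalized`): for every choice of
members `e_j ∈ poly_j` and regions `S_j`, the averaged volumes agree. [claim: Mochizuki2012, status: disputed] -/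
theorem processionNormalized_congr_of_compat {lstar : ℕ} {XD XF : Fin lstar → Type u}
    (poly : ∀ j, Set (XD j ≃ XF j)) (μD : ∀ j, Set (XD j) → ℝ) (μF : ∀ j, Set (XF j) → ℝ)
    (h : ∀ j, Prop39ii_monoAnalyticCompat (poly j) (μD j) (μF j))
    (e : ∀ j, XD j ≃ XF j) (he : ∀ j, e j ∈ poly j) (S : ∀ j, Set (XD j)) :
    processionNormalized (fun j => μD j (S j)) = processionNormalized (fun j => μF j (e j '' S j)) := by
  congr 1
  funext j
  exact h j (e j) (he j) (S j)

end Procession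

end Literature.IUT.LogThetaLattice
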